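import Literature.NumberTheory.Sieve.PretentiousDistance
import HarnessLib

/-!
# Discharge of `Literature.NumberTheory.Sieve.pretentiousDist_triangle` (Granville–Soundararajan)

Topic: `Literature/NumberTheory/Sieve`. Sibling proof file of `PretentiousDistance.lean`: the
named fact `Literature.NumberTheory.Sieve.pretentiousDist_triangle` — the **triangle inequality**
`𝔻(f, h; x) ≤ 𝔻(f, g; x) + 𝔻(g, h; x)` for the Granville–Soundararajan pretentious distance
between `1`-bounded `f, g, h : ℕ → ℂ` — is PROVED here, from Mathlib only.

* `Literature.NumberTheory.Sieve.pretentiousDist_triangle_holds : pretentiousDist_triangle`.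

## The printed argument and ours

Granville–Soundararajan obtain the triangle inequality for the weighted `ℓ²`-type "norms"
`‖z‖ = (∑ⱼ ηⱼ(zⱼ)²)^{1/2}` built from pointwise sub-additive `ηⱼ : 𝕌 → ℝ≥0`
(`ηⱼ(zw) ≤ ηⱼ(z) + ηⱼ(w)`) by expanding the square and applying Cauchy–Schwarz
(Granville–Soundararajan 2008, §2, proof of eq. (5) `‖z × w‖ ≤ ‖z‖ + ‖w‖`; the same
computation is Granville–Soundararajan 2007, Lemma 3.1, for the multiplicative form
`𝔻(z₁, w₁; y) + 𝔻(z₂, w₂; y) ≥ 𝔻(z₁z₂, w₁w₂; y)`), and specialise to `ηⱼ(z)² = aⱼ (1 - Re z)`,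
`aⱼ = 1/p` for primes `p ≤ x`, getting `𝔻(1, f; x) + 𝔻(1, g; x) ≥ 𝔻(1, fg; x)`.

For the three-function form on the *closed* unit disc (the vendored statement assumes only
`1`-boundedness, not unimodularity, so the reduction `𝔻(f, g) = 𝔻(1, f̄g)` to the multiplicative
form is not available) we use the pointwise inequality
`√(1 - Re z w̄) ≤ √(1 - Re z v̄) + √(1 - Re v w̄)` for `|z|, |v|, |w| ≤ 1`
(`sqrt_one_sub_re_mul_conj_le`), which follows from the identity
`2 (1 - Re z w̄) = (1 - |z|²) + (1 - |w|²) + |z - w|²` and Minkowski's inequality in `ℝ²`;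
the `ℓ²` step (`sqrt_sum_le_sqrt_sum_add_sqrt_sum`) is then exactly the Cauchy–Schwarz
computation of the source.

## References

* A. Granville, K. Soundararajan, *Pretentious multiplicative functions and an inequality for the
  zeta-function*, in: Anatomy of Integers, CRM Proc. Lecture Notes 46, AMS (2008), 191–197,
  §2, eq. (5) and the display `𝔻(1,f;x) + 𝔻(1,g;x) ≥ 𝔻(1,fg;x)`; arXiv:math/0608407.
  [GranvilleSoundararajan2008]
* A. Granville, K. Soundararajan, *Large character sums: pretentious characters and the
  Pólya–Vinogradov theorem*, J. Amer. Math. Soc. 20 (2007), 357–384, Lemma 3.1;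
  arXiv:math/0503113. [GranvilleSoundararajan2007]
-/

open scoped ComplexConjugate
open Complex

noncomputable section

namespace Literature.NumberTheory.Sieve

variable {f g h : ℕ → ℂ}

/-- Minkowski's inequality in `ℝ²`, phrased with `Real.sqrt`: the Euclidean length of
`(a + b, m + n)` is at most the sum of the lengths of `(a, m)` and `(b, n)` (the triangle
inequality for the complex numbers `a + m i`, `b + n i`). [folklore] -/
theorem sqrt_add_sq_add_add_sq_le (a b m n : ℝ) :
    √((a + b) ^ 2 + (m + n) ^ 2) ≤ √(a ^ 2 + m ^ 2) + √(b ^ 2 + n ^ 2) := by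
  have key := norm_add_le ((a : ℂ) + m * I) ((b : ℂ) + n * I)
  have e : ((a : ℂ) + m * I) + ((b : ℂ) + n * I) = ((a + b : ℝ) : ℂ) + ((m + n : ℝ) : ℂ) * I := by
    push_cast
    ring
  rwa [e, Complex.norm_add_mul_I, Complex.norm_add_mul_I, Complex.norm_add_mul_I] at key

/-- Abstract form of the pointwise step: if `A, B ≥ 0`, `0 ≤ k ≤ m + n`, `A + m² ≤ S` and
`B + n² ≤ T`, then `√(A + B + k²) ≤ √S + √T`. [folklore] -/
theorem sqrt_add_add_sq_le_sqrt_add_sqrt {A B S T m n k : ℝ} (hA : 0 ≤ A) (hB : 0 ≤ B)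
    (hk : 0 ≤ k) (hkmn : k ≤ m + n) (hS : A + m ^ 2 ≤ S) (hT : B + n ^ 2 ≤ T) :
    √(A + B + k ^ 2) ≤ √S + √T := by
  have hk2 : k ^ 2 ≤ (m + n) ^ 2 := pow_le_pow_left₀ hk hkmn 2
  have hAB : A + B ≤ (√A + √B) ^ 2 := by
    rw [add_sq, Real.sq_sqrt hA, Real.sq_sqrt hB]
    nlinarith [Real.sqrt_nonneg A, Real.sqrt_nonneg B]
  calc √(A + B + k ^ 2) ≤ √((√A + √B) ^ 2 + (m + n) ^ 2) := Real.sqrt_le_sqrt (by linarith)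
    _ ≤ √((√A) ^ 2 + m ^ 2) + √((√B) ^ 2 + n ^ 2) := sqrt_add_sq_add_add_sq_le _ _ _ _
    _ = √(A + m ^ 2) + √(B + n ^ 2) := by rw [Real.sq_sqrt hA, Real.sq_sqrt hB]
    _ ≤ √S + √T := add_le_add (Real.sqrt_le_sqrt hS) (Real.sqrt_le_sqrt hT)

/-- The identity behind the pointwise triangle inequality on the closed unit disc:
`2 (1 - Re (a b̄)) = (1 - |a|²) + (1 - |b|²) + |a - b|²`. [folklore] -/
theorem two_mul_one_sub_re_mul_conj (a b : ℂ) :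
    2 * (1 - (a * conj b).re) = (1 - ‖a‖ ^ 2) + (1 - ‖b‖ ^ 2) + ‖a - b‖ ^ 2 := by
  rw [← Complex.normSq_eq_norm_sq, ← Complex.normSq_eq_norm_sq, ← Complex.normSq_eq_norm_sq,
    Complex.normSq_sub]
  ring

/-- **Pointwise triangle inequality on the closed unit disc**: for `|z|, |v|, |w| ≤ 1`,
`√(1 - Re (z w̄)) ≤ √(1 - Re (z v̄)) + √(1 - Re (v w̄))`, i.e. `(z, w) ↦ √(1 - Re (z w̄))`
satisfies the triangle inequality on `𝕌 = {|z| ≤ 1}` (it is a metric on the unit circle, where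
`1 - Re (z w̄) = |z - w|² / 2`). Granville–Soundararajan 2008, §2 (after (5)) verify the
sub-additivity of `η(z)² = 1 - Re z` for `|z| = |w| = 1` via `1 - Re e^{2πiθ} = 2 sin² πθ` and
note that "one can extend this to all pairs `z, w ∈ 𝕌`"; here the closed-disc case is obtained
from `two_mul_one_sub_re_mul_conj` and Minkowski's inequality in `ℝ²`.
[cite: GranvilleSoundararajan2008, §2, discussion after eq. (5)] -/
theorem sqrt_one_sub_re_mul_conj_le {z v w : ℂ} (hz : ‖z‖ ≤ 1) (hv : ‖v‖ ≤ 1) (hw : ‖w‖ ≤ 1) :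
    √(1 - (z * conj w).re) ≤ √(1 - (z * conj v).re) + √(1 - (v * conj w).re) := by
  have hA : 0 ≤ 1 - ‖z‖ ^ 2 := by nlinarith [norm_nonneg z]
  have hB : 0 ≤ 1 - ‖w‖ ^ 2 := by nlinarith [norm_nonneg w]
  have hC : 0 ≤ 1 - ‖v‖ ^ 2 := by nlinarith [norm_nonneg v]
  have htri : ‖z - w‖ ≤ ‖z - v‖ + ‖v - w‖ := by
    simpa only [sub_add_sub_cancel] using norm_add_le (z - v) (v - w)
  have h2 : √(2 * (1 - (z * conj w).re)) ≤
      √(2 * (1 - (z * conj v).re)) + √(2 * (1 - (v * conj w).re)) := by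
    rw [two_mul_one_sub_re_mul_conj z w]
    refine sqrt_add_add_sq_le_sqrt_add_sqrt hA hB (norm_nonneg _) htri ?_ ?_
    · rw [two_mul_one_sub_re_mul_conj z v]
      linarith
    · rw [two_mul_one_sub_re_mul_conj v w]
      linarith
  rw [Real.sqrt_mul zero_le_two, Real.sqrt_mul zero_le_two, Real.sqrt_mul zero_le_two,
    ← mul_add] at h2
  exact le_of_mul_le_mul_left h2 (Real.sqrt_pos.2 zero_lt_two)

/-- **Minkowski's inequality in weighted `ℓ²`, finite form** — the Cauchy–Schwarz step of
Granville–Soundararajan (2008, proof of (5); 2007, proof of Lemma 3.1): if `0 ≤ u i, s i, t i`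
and `√(u i) ≤ √(s i) + √(t i)` termwise on `S`, then `√(∑_S u) ≤ √(∑_S s) + √(∑_S t)`.
[cite: GranvilleSoundararajan2008, §2, proof of eq. (5)] -/
theorem sqrt_sum_le_sqrt_sum_add_sqrt_sum {ι : Type*} (S : Finset ι) {u s t : ι → ℝ}
    (hu : ∀ i, 0 ≤ u i) (hs : ∀ i, 0 ≤ s i) (ht : ∀ i, 0 ≤ t i)
    (hle : ∀ i ∈ S, √(u i) ≤ √(s i) + √(t i)) :
    √(∑ i ∈ S, u i) ≤ √(∑ i ∈ S, s i) + √(∑ i ∈ S, t i) := by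
  have hS0 : 0 ≤ ∑ i ∈ S, s i := Finset.sum_nonneg fun i _ ↦ hs i
  have hT0 : 0 ≤ ∑ i ∈ S, t i := Finset.sum_nonneg fun i _ ↦ ht i
  have key : ∑ i ∈ S, u i ≤ (√(∑ i ∈ S, s i) + √(∑ i ∈ S, t i)) ^ 2 :=
    calc ∑ i ∈ S, u i ≤ ∑ i ∈ S, (s i + t i + 2 * (√(s i) * √(t i))) := by
          refine Finset.sum_le_sum fun i hi ↦ ?_
          have h1 : (√(u i)) ^ 2 = u i := Real.sq_sqrt (hu i)
          have h2 : (√(u i)) ^ 2 ≤ (√(s i) + √(t i)) ^ 2 :=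
            pow_le_pow_left₀ (Real.sqrt_nonneg _) (hle i hi) 2
          rw [add_sq, Real.sq_sqrt (hs i), Real.sq_sqrt (ht i)] at h2
          linarith
      _ = ∑ i ∈ S, s i + ∑ i ∈ S, t i + 2 * ∑ i ∈ S, √(s i) * √(t i) := by
          rw [Finset.sum_add_distrib, Finset.sum_add_distrib, Finset.mul_sum]
      _ ≤ ∑ i ∈ S, s i + ∑ i ∈ S, t i + 2 * (√(∑ i ∈ S, s i) * √(∑ i ∈ S, t i)) := by
          have := Real.sum_sqrt_mul_sqrt_le S hs ht
          linarith
      _ = (√(∑ i ∈ S, s i) + √(∑ i ∈ S, t i)) ^ 2 := by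
          rw [add_sq, Real.sq_sqrt hS0, Real.sq_sqrt hT0]
          ring
  calc √(∑ i ∈ S, u i) ≤ √((√(∑ i ∈ S, s i) + √(∑ i ∈ S, t i)) ^ 2) := Real.sqrt_le_sqrt key
    _ = √(∑ i ∈ S, s i) + √(∑ i ∈ S, t i) := Real.sqrt_sq (by positivity)

/-- For `1`-bounded `a, b : ℕ → ℂ` every summand `(1 - Re (a p · conj (b p))) / p` of the squared
pretentious distance is nonnegative (for every `p : ℕ`, with `0` at `p = 0`). [folklore] -/
theorem pretentiousDistSq_summand_nonneg {a b : ℕ → ℂ} (ha : ∀ n, ‖a n‖ ≤ 1)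
    (hb : ∀ n, ‖b n‖ ≤ 1) (p : ℕ) : 0 ≤ (1 - (a p * conj (b p)).re) / (p : ℝ) := by
  refine div_nonneg (sub_nonneg.mpr ?_) (Nat.cast_nonneg p)
  calc (a p * conj (b p)).re ≤ ‖a p * conj (b p)‖ := Complex.re_le_norm _
    _ = ‖a p‖ * ‖b p‖ := by rw [norm_mul, Complex.norm_conj]
    _ ≤ 1 * 1 := mul_le_mul (ha p) (hb p) (norm_nonneg _) zero_le_one
    _ = 1 := one_mul 1

/-- **Discharge** of `pretentiousDist_triangle` — the **triangle inequality**
`𝔻(f, h; x) ≤ 𝔻(f, g; x) + 𝔻(g, h; x)` for `1`-bounded `f, g, h : ℕ → ℂ`.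
Proof: termwise `√((1 - Re f(p)h̄(p))/p) ≤ √((1 - Re f(p)ḡ(p))/p) + √((1 - Re g(p)h̄(p))/p)`
by `sqrt_one_sub_re_mul_conj_le` (closed unit disc), then the weighted-`ℓ²` Minkowski step
`sqrt_sum_le_sqrt_sum_add_sqrt_sum` (expand the square and use Cauchy–Schwarz, exactly as in
the source). (Granville–Soundararajan 2008, §2: eq. (5) `‖z × w‖ ≤ ‖z‖ + ‖w‖` with
`ηⱼ(z)² = aⱼ(1 - Re z)`, whence `𝔻(1, f; x) + 𝔻(1, g; x) ≥ 𝔻(1, fg; x)`; Granville–Soundararajan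
2007 (JAMS 20), Lemma 3.1: `𝔻(z₁, w₁; y) + 𝔻(z₂, w₂; y) ≥ 𝔻(z₁z₂, w₁w₂; y)`.)
[cite: GranvilleSoundararajan2008, §2, eq. (5) and the display after it] -/
theorem pretentiousDist_triangle_holds : pretentiousDist_triangle (f := f) (g := g) (h := h) := by
  intro hf hg hh x
  unfold pretentiousDist pretentiousDistSq
  refine sqrt_sum_le_sqrt_sum_add_sqrt_sum _ (pretentiousDistSq_summand_nonneg hf hh)
    (pretentiousDistSq_summand_nonneg hf hg) (pretentiousDistSq_summand_nonneg hg hh)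
    fun p _ ↦ ?_
  rw [Real.sqrt_div' _ (Nat.cast_nonneg p), Real.sqrt_div' _ (Nat.cast_nonneg p),
    Real.sqrt_div' _ (Nat.cast_nonneg p), ← add_div]
  exact div_le_div_of_nonneg_right (sqrt_one_sub_re_mul_conj_le (hf p) (hg p) (hh p))
    (Real.sqrt_nonneg _)

end Literature.NumberTheory.Sieve
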